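import Mathlib
import HarnessLib

/-!
# Route `PoloidalWindowDoor`, item `LrcModEntire` (stmt-NavierStokesRegularity-20428), cell (Q4) of the (TH) column —
# CAUCHY–KOVALEVSKAYA UNIQUENESS ACROSS A NON-CHARACTERISTIC SHEET (class-free core of LEAD memo T2B-g16 §3)

Cell ns-regularity-ideate, LEAD-lineage seat ns-poloidal-K2-p3 g16 (`--supports stmt-NavierStokesRegularity-20428`).
Class-free calculus brick C1 of the kernel plan of `stub_Q4line` (memo `Cruxes/LrcModEntire/T2B-g16.md` §6(iii)).

In flattened coordinates `p = (s, n, z)` (the web-sheet is `{n = 0}`) let a smooth `H` solve the second-order equation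

  `∂_z∂_zH + A(z)·∂_z∂_nH + B(z)·∂_nH + Q(z)·∂_n∂_nH + μ(z)·∂_s∂_sH = 0`

on the open slab `{z ∈ I}`, with coefficients depending on the height `z` only, and suppose `H = 0` and `∂_nH = 0` on the
sheet `{n = 0, z ∈ I}` (zero Cauchy data) while `Q ≠ 0` on `I` (the sheet is NON-CHARACTERISTIC).  Then every iterated
`n`-derivative of `H` vanishes on the sheet (`iterate_pdN_eq_zero_on_sheet`, induction on the order: the equation for
`∂_n^jH` — which holds because the coefficients do not depend on `n` and partial derivatives of smooth functions commute —
evaluated on the sheet gives `Q·∂_n^{j+2}H = 0` there, all other terms being tangential derivatives of vanishing data);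
if moreover the `n`-lines of `H` are real-analytic, `H` vanishes on the whole slab (`eq_zero_on_slab`: infinite analytic
order at `n = 0`, `analyticOrderAt_eq_top`, identity theorem on `ℝ`).

In the application (memo §3) `H(s,n,z) = ∂_eθ(s·e + (n + d(z))·ν + z·e₂)` for the signed vertical velocity `θ` of a hull
element, `e` the direction of a straight hot branch, `A = −2d′`, `B = −d″`, `Q = d′² + μ` (non-zero iff the homogeneous
ridge height `R(0,·)` has `R″ ≠ 0` at that height); the conclusion `∂_eθ ≡ 0` on a slab is a vorticity translation germ.

WHAT THIS IS NOT: not a claim about Navier–Stokes regularity; a calculus lemma (bears_on LADDER-NS N0 via item 20428).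
-/

noncomputable section

set_option linter.dupNamespace false
set_option linter.unusedVariables false

namespace Summit.NavierStokesRegularity.NavierStokesRegularity.Theorems.PoloidalWindowDoorLrcModEntireSheetCauchyUniqueness

open Set Function Filter Topology
open scoped ContDiff

/-- The tangential direction `∂_s` of the flattened coordinates `(s, n, z)`. -/
def eS : ℝ × ℝ × ℝ := (1, 0, 0)
/-- The normal direction `∂_n` (the sheet is `{n = 0}`). -/
def eN : ℝ × ℝ × ℝ := (0, 1, 0)
/-- The height direction `∂_z`. -/
def eZ : ℝ × ℝ × ℝ := (0, 0, 1)

/-- Directional partial derivative operator `∂_v H (p) = DH(p)[v]`. -/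
def pd (v : ℝ × ℝ × ℝ) (H : ℝ × ℝ × ℝ → ℝ) : ℝ × ℝ × ℝ → ℝ := fun p => fderiv ℝ H p v

/-- The open slab `{z ∈ I}`. -/
def slab (I : Set ℝ) : Set (ℝ × ℝ × ℝ) := {p | p.2.2 ∈ I}

/-- The slab over an open set of heights is open. -/
theorem isOpen_slab {I : Set ℝ} (hI : IsOpen I) : IsOpen (slab I) :=
  hI.preimage (continuous_snd.comp continuous_snd)

/-! ### Calculus of the partial derivative operators on the slab -/

/-- A smooth function on the open slab has smooth partial derivatives there. -/
theorem contDiffOn_pd {I : Set ℝ} (hI : IsOpen I) {H : ℝ × ℝ × ℝ → ℝ} (hH : ContDiffOn ℝ ∞ H (slab I))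
    (v : ℝ × ℝ × ℝ) : ContDiffOn ℝ ∞ (pd v H) (slab I) := by
  have h1 : ContDiffOn ℝ ∞ (fderiv ℝ H) (slab I) := by
    have h := hH.fderiv_of_isOpen (isOpen_slab hI) (m := ∞) (by simp)
    exact h
  exact h1.clm_apply contDiffOn_const

/-- Iterated partial derivatives stay smooth on the slab. -/
theorem contDiffOn_iterate_pd {I : Set ℝ} (hI : IsOpen I) {H : ℝ × ℝ × ℝ → ℝ} (hH : ContDiffOn ℝ ∞ H (slab I))
    (v : ℝ × ℝ × ℝ) (j : ℕ) : ContDiffOn ℝ ∞ ((pd v)^[j] H) (slab I) := by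
  induction j with
  | zero => simpa using hH
  | succ j ih =>
    rw [Function.iterate_succ', Function.comp]
    exact contDiffOn_pd hI ih v

/-- At a point of the slab, `∂_v(∂_w H) = D²H[v][w]`. -/
theorem pd_pd_eq_fderiv_fderiv {I : Set ℝ} (hI : IsOpen I) {H : ℝ × ℝ × ℝ → ℝ} (hH : ContDiffOn ℝ ∞ H (slab I))
    (v w : ℝ × ℝ × ℝ) {p : ℝ × ℝ × ℝ} (hp : p ∈ slab I) :
    pd v (pd w H) p = fderiv ℝ (fderiv ℝ H) p v w := by
  have hHp : ContDiffAt ℝ ∞ H p := hH.contDiffAt ((isOpen_slab hI).mem_nhds hp)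
  have hD : DifferentiableAt ℝ (fderiv ℝ H) p :=
    ((hHp.fderiv_right (m := 1) (by norm_cast)).differentiableAt (by norm_num))
  unfold pd
  rw [fderiv_clm_apply hD (differentiableAt_const w)]
  simp

/-- **Partial derivatives of a smooth function commute** on the open slab. -/
theorem pd_comm {I : Set ℝ} (hI : IsOpen I) {H : ℝ × ℝ × ℝ → ℝ} (hH : ContDiffOn ℝ ∞ H (slab I))
    (v w : ℝ × ℝ × ℝ) {p : ℝ × ℝ × ℝ} (hp : p ∈ slab I) :
    pd v (pd w H) p = pd w (pd v H) p := by
  rw [pd_pd_eq_fderiv_fderiv hI hH v w hp, pd_pd_eq_fderiv_fderiv hI hH w v hp]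
  have hHp : ContDiffAt ℝ ∞ H p := hH.contDiffAt ((isOpen_slab hI).mem_nhds hp)
  exact hHp.isSymmSndFDerivAt (by simp only [minSmoothness_of_isRCLikeNormedField]; norm_cast) v w

/-- `pd` respects eventual equality. -/
theorem pd_congr_of_eventuallyEq {H₁ H₂ : ℝ × ℝ × ℝ → ℝ} (v : ℝ × ℝ × ℝ) {p : ℝ × ℝ × ℝ} (h : H₁ =ᶠ[𝓝 p] H₂) :
    pd v H₁ p = pd v H₂ p := by
  unfold pd
  rw [h.fderiv_eq]

/-- `pd` respects equality on the open slab. -/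
theorem pd_congr_on_slab {I : Set ℝ} (hI : IsOpen I) {H₁ H₂ : ℝ × ℝ × ℝ → ℝ} (v : ℝ × ℝ × ℝ)
    (h : ∀ p ∈ slab I, H₁ p = H₂ p) {p : ℝ × ℝ × ℝ} (hp : p ∈ slab I) : pd v H₁ p = pd v H₂ p :=
  pd_congr_of_eventuallyEq v (Filter.eventuallyEq_of_mem ((isOpen_slab hI).mem_nhds hp) h)

/-- The partial derivative of a function of the height alone in a horizontal direction vanishes. -/
theorem pd_heightFun_eq_zero {c : ℝ → ℝ} {z : ℝ} (hc : DifferentiableAt ℝ c z) (s n : ℝ) {v : ℝ × ℝ × ℝ}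
    (hv : v.2.2 = 0) : pd v (fun p : ℝ × ℝ × ℝ => c p.2.2) (s, n, z) = 0 := by
  unfold pd
  have hproj : HasFDerivAt (fun p : ℝ × ℝ × ℝ => p.2.2)
      ((ContinuousLinearMap.snd ℝ ℝ ℝ).comp (ContinuousLinearMap.snd ℝ ℝ (ℝ × ℝ))) (s, n, z) :=
    ((ContinuousLinearMap.snd ℝ ℝ ℝ).comp (ContinuousLinearMap.snd ℝ ℝ (ℝ × ℝ))).hasFDerivAt
  have hcz : HasFDerivAt c (fderiv ℝ c z) ((fun p : ℝ × ℝ × ℝ => p.2.2) (s, n, z)) := hc.hasFDerivAt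
  have h : HasFDerivAt (fun p : ℝ × ℝ × ℝ => c p.2.2)
      ((fderiv ℝ c z).comp ((ContinuousLinearMap.snd ℝ ℝ ℝ).comp (ContinuousLinearMap.snd ℝ ℝ (ℝ × ℝ)))) (s, n, z) :=
    HasFDerivAt.comp ((s, n, z) : ℝ × ℝ × ℝ) hcz hproj
  rw [h.fderiv]
  simp [hv]

/-- **A function vanishing on the sheet has vanishing TANGENTIAL derivatives there**: if `K(s,0,z) = 0` for all `s` and all
`z ∈ I` (`I` open) then `∂_vK(s,0,z) = 0` for every direction `v` with `v.2.1 = 0` (tangent to the sheet). -/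
theorem pd_eq_zero_of_vanish_on_sheet {I : Set ℝ} (hI : IsOpen I) {K : ℝ × ℝ × ℝ → ℝ}
    (hK : ∀ s : ℝ, ∀ z ∈ I, K (s, 0, z) = 0) {s z : ℝ} (hz : z ∈ I) (hd : DifferentiableAt ℝ K (s, 0, z))
    {v : ℝ × ℝ × ℝ} (hv : v.2.1 = 0) : pd v K (s, 0, z) = 0 := by
  unfold pd
  -- the line `t ↦ (s,0,z) + t v` stays in the sheet, where `K` vanishes near `t = 0`
  have hline : HasDerivAt (fun t : ℝ => K ((s, 0, z) + t • v)) (fderiv ℝ K (s, 0, z) v) 0 := by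
    have h1 : HasFDerivAt K (fderiv ℝ K (s, 0, z)) ((s, 0, z) + (0 : ℝ) • v) := by
      simpa using hd.hasFDerivAt
    have h2 : HasDerivAt (fun t : ℝ => ((s, 0, z) : ℝ × ℝ × ℝ) + t • v) v 0 := by
      simpa using ((hasDerivAt_id (0 : ℝ)).smul_const v).const_add ((s, 0, z) : ℝ × ℝ × ℝ)
    exact h1.comp_hasDerivAt 0 h2
  have hzero : (fun t : ℝ => K ((s, 0, z) + t • v)) =ᶠ[𝓝 0] fun _ => 0 := by
    have hIo : ∀ᶠ t : ℝ in 𝓝 0, z + t * v.2.2 ∈ I := by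
      have hcont : Continuous fun t : ℝ => z + t * v.2.2 := by fun_prop
      have h0 : z + 0 * v.2.2 ∈ I := by simpa using hz
      exact hcont.continuousAt.preimage_mem_nhds (hI.mem_nhds h0)
    filter_upwards [hIo] with t ht
    have : ((s, 0, z) : ℝ × ℝ × ℝ) + t • v = (s + t * v.1, 0, z + t * v.2.2) := by
      ext <;> simp [hv]
    rw [this]
    exact hK _ _ ht
  have h0 : HasDerivAt (fun t : ℝ => K ((s, 0, z) + t • v)) 0 0 := by
    have := (hasDerivAt_const (0 : ℝ) (0 : ℝ)).congr_of_eventuallyEq hzero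
    simpa using this
  exact hline.unique h0


/-- A smooth function on the slab is differentiable at its points. -/
theorem differentiableAt_of_slab {I : Set ℝ} (hI : IsOpen I) {K : ℝ × ℝ × ℝ → ℝ} (hK : ContDiffOn ℝ ∞ K (slab I))
    {p : ℝ × ℝ × ℝ} (hp : p ∈ slab I) : DifferentiableAt ℝ K p :=
  (hK.contDiffAt ((isOpen_slab hI).mem_nhds hp)).differentiableAt (by simp)

/-- Sheet points lie in the slab. -/
theorem sheet_mem_slab {I : Set ℝ} (s : ℝ) {z : ℝ} (hz : z ∈ I) : ((s, 0, z) : ℝ × ℝ × ℝ) ∈ slab I := hz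

/-! ### The flattened slice operator and its commutation with `∂_n` -/

/-- The flattened slice operator `P H = ∂_z∂_zH + A(z)·∂_z∂_nH + B(z)·∂_nH + Q(z)·∂_n∂_nH + μ(z)·∂_s∂_sH`
(coefficients depend on the height only). -/
def sheetOp (A B Q μ : ℝ → ℝ) (H : ℝ × ℝ × ℝ → ℝ) : ℝ × ℝ × ℝ → ℝ := fun p =>
  pd eZ (pd eZ H) p + A p.2.2 * pd eZ (pd eN H) p + B p.2.2 * pd eN H p + Q p.2.2 * pd eN (pd eN H) p +
    μ p.2.2 * pd eS (pd eS H) p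

/-- Differentiating a product `c(z)·K` in a horizontal direction only differentiates `K`. -/
theorem pd_heightFun_mul {I : Set ℝ} (hI : IsOpen I) {c : ℝ → ℝ} (hc : ∀ z ∈ I, DifferentiableAt ℝ c z)
    {K : ℝ × ℝ × ℝ → ℝ} (hK : ContDiffOn ℝ ∞ K (slab I)) {v : ℝ × ℝ × ℝ} (hv : v.2.2 = 0)
    {p : ℝ × ℝ × ℝ} (hp : p ∈ slab I) :
    pd v (fun q : ℝ × ℝ × ℝ => c q.2.2 * K q) p = c p.2.2 * pd v K p := by
  obtain ⟨s, n, z⟩ := p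
  have hz : z ∈ I := hp
  have hcd : DifferentiableAt ℝ (fun q : ℝ × ℝ × ℝ => c q.2.2) (s, n, z) := by
    have hproj : DifferentiableAt ℝ (fun q : ℝ × ℝ × ℝ => q.2.2) (s, n, z) :=
      differentiableAt_snd.comp _ differentiableAt_snd
    exact (hc z hz).comp ((s, n, z) : ℝ × ℝ × ℝ) hproj
  have hKd : DifferentiableAt ℝ K (s, n, z) := differentiableAt_of_slab hI hK hp
  unfold pd
  rw [fderiv_fun_mul hcd hKd]
  simp only [_root_.add_apply, _root_.smul_apply, smul_eq_mul]
  have h0 : fderiv ℝ (fun q : ℝ × ℝ × ℝ => c q.2.2) (s, n, z) v = 0 := pd_heightFun_eq_zero (hc z hz) s n hv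
  rw [h0]
  ring

/-- **`∂_n` commutes with the flattened slice operator**: if `P H = 0` on the open slab then `P(∂_nH) = 0` there. -/
theorem sheetOp_pdN_eq_zero {I : Set ℝ} (hI : IsOpen I) {A B Q μ : ℝ → ℝ}
    (hA : ∀ z ∈ I, DifferentiableAt ℝ A z) (hB : ∀ z ∈ I, DifferentiableAt ℝ B z)
    (hQ : ∀ z ∈ I, DifferentiableAt ℝ Q z) (hμ : ∀ z ∈ I, DifferentiableAt ℝ μ z)
    {H : ℝ × ℝ × ℝ → ℝ} (hH : ContDiffOn ℝ ∞ H (slab I))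
    (hpde : ∀ p ∈ slab I, sheetOp A B Q μ H p = 0) :
    ∀ p ∈ slab I, sheetOp A B Q μ (pd eN H) p = 0 := by
  intro p hp
  have hN0 : eN.2.2 = 0 := rfl
  -- smoothness of all the pieces
  have hZ := contDiffOn_pd hI hH eZ
  have hNs := contDiffOn_pd hI hH eN
  have hSs := contDiffOn_pd hI hH eS
  have hZZ := contDiffOn_pd hI hZ eZ
  have hZN := contDiffOn_pd hI hNs eZ
  have hNN := contDiffOn_pd hI hNs eN
  have hSS := contDiffOn_pd hI hSs eS
  -- `∂_n (P H) = 0` at `p`, since `P H` vanishes on the open slab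
  have hzero : pd eN (sheetOp A B Q μ H) p = 0 := by
    have h : sheetOp A B Q μ H =ᶠ[𝓝 p] fun _ => 0 :=
      Filter.eventuallyEq_of_mem ((isOpen_slab hI).mem_nhds hp) fun q hq => hpde q hq
    rw [pd_congr_of_eventuallyEq eN h]
    simp [pd]
  -- expand `∂_n (P H)` term by term
  have hd1 : DifferentiableAt ℝ (pd eZ (pd eZ H)) p := differentiableAt_of_slab hI hZZ hp
  have hcoef : ∀ {c : ℝ → ℝ}, (∀ z ∈ I, DifferentiableAt ℝ c z) → ∀ {K : ℝ × ℝ × ℝ → ℝ}, ContDiffOn ℝ ∞ K (slab I) →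
      DifferentiableAt ℝ (fun q : ℝ × ℝ × ℝ => c q.2.2 * K q) p := by
    intro c hc K hK
    have hproj : DifferentiableAt ℝ (fun q : ℝ × ℝ × ℝ => q.2.2) p := differentiableAt_snd.comp _ differentiableAt_snd
    exact ((hc p.2.2 hp).comp p hproj).mul (differentiableAt_of_slab hI hK hp)
  have hd2 := hcoef hA hZN
  have hd3 := hcoef hB hNs
  have hd4 := hcoef hQ hNN
  have hd5 := hcoef hμ hSS
  have hsum : pd eN (sheetOp A B Q μ H) p =
      pd eN (pd eZ (pd eZ H)) p + pd eN (fun q : ℝ × ℝ × ℝ => A q.2.2 * pd eZ (pd eN H) q) p +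
        pd eN (fun q : ℝ × ℝ × ℝ => B q.2.2 * pd eN H q) p + pd eN (fun q : ℝ × ℝ × ℝ => Q q.2.2 * pd eN (pd eN H) q) p +
        pd eN (fun q : ℝ × ℝ × ℝ => μ q.2.2 * pd eS (pd eS H) q) p := by
    have hF : HasFDerivAt (sheetOp A B Q μ H)
        (fderiv ℝ (pd eZ (pd eZ H)) p + fderiv ℝ (fun q : ℝ × ℝ × ℝ => A q.2.2 * pd eZ (pd eN H) q) p +
          fderiv ℝ (fun q : ℝ × ℝ × ℝ => B q.2.2 * pd eN H q) p +
          fderiv ℝ (fun q : ℝ × ℝ × ℝ => Q q.2.2 * pd eN (pd eN H) q) p +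
          fderiv ℝ (fun q : ℝ × ℝ × ℝ => μ q.2.2 * pd eS (pd eS H) q) p) p :=
      (((hd1.hasFDerivAt.add hd2.hasFDerivAt).add hd3.hasFDerivAt).add hd4.hasFDerivAt).add hd5.hasFDerivAt
    unfold pd
    rw [hF.fderiv]
    simp only [_root_.add_apply]
    rfl
  rw [hsum, pd_heightFun_mul hI hA hZN hN0 hp, pd_heightFun_mul hI hB hNs hN0 hp, pd_heightFun_mul hI hQ hNN hN0 hp,
    pd_heightFun_mul hI hμ hSS hN0 hp] at hzero
  -- commute `∂_n` past `∂_z∂_z`, `∂_z` and `∂_s∂_s`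
  have c1 : pd eN (pd eZ (pd eZ H)) p = pd eZ (pd eZ (pd eN H)) p := by
    rw [pd_comm hI hZ eN eZ hp]
    exact pd_congr_on_slab hI eZ (fun q hq => pd_comm hI hH eN eZ hq) hp
  have c2 : pd eN (pd eZ (pd eN H)) p = pd eZ (pd eN (pd eN H)) p := pd_comm hI hNs eN eZ hp
  have c3 : pd eN (pd eS (pd eS H)) p = pd eS (pd eS (pd eN H)) p := by
    rw [pd_comm hI hSs eN eS hp]
    exact pd_congr_on_slab hI eS (fun q hq => pd_comm hI hH eN eS hq) hp
  rw [c1, c2, c3] at hzero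
  simpa [sheetOp] using hzero

/-! ### The Cauchy–Kovalevskaya induction -/

/-- **All iterated normal derivatives vanish on a non-characteristic sheet carrying zero Cauchy data.** -/
theorem iterate_pdN_eq_zero_on_sheet {I : Set ℝ} (hI : IsOpen I) {A B Q μ : ℝ → ℝ}
    (hA : ∀ z ∈ I, DifferentiableAt ℝ A z) (hB : ∀ z ∈ I, DifferentiableAt ℝ B z)
    (hQd : ∀ z ∈ I, DifferentiableAt ℝ Q z) (hμ : ∀ z ∈ I, DifferentiableAt ℝ μ z)
    (hQ : ∀ z ∈ I, Q z ≠ 0)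
    {H : ℝ × ℝ × ℝ → ℝ} (hH : ContDiffOn ℝ ∞ H (slab I))
    (hpde : ∀ p ∈ slab I, sheetOp A B Q μ H p = 0)
    (h0 : ∀ s : ℝ, ∀ z ∈ I, H (s, 0, z) = 0) (h1 : ∀ s : ℝ, ∀ z ∈ I, pd eN H (s, 0, z) = 0) :
    ∀ (j : ℕ) (s : ℝ), ∀ z ∈ I, ((pd eN)^[j] H) (s, 0, z) = 0 := by
  -- strengthened induction: the `j`-th iterate solves the equation and vanishes on the sheet together with the next one
  have key : ∀ j : ℕ, (∀ p ∈ slab I, sheetOp A B Q μ ((pd eN)^[j] H) p = 0) ∧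
      (∀ s : ℝ, ∀ z ∈ I, ((pd eN)^[j] H) (s, 0, z) = 0) ∧
      (∀ s : ℝ, ∀ z ∈ I, ((pd eN)^[j + 1] H) (s, 0, z) = 0) := by
    intro j
    induction j with
    | zero =>
      refine ⟨by simpa using hpde, by simpa using h0, ?_⟩
      simpa using h1
    | succ j ih =>
      obtain ⟨ihP, ihV, ihV1⟩ := ih
      have hKj : ContDiffOn ℝ ∞ ((pd eN)^[j] H) (slab I) := contDiffOn_iterate_pd hI hH eN j
      refine ⟨?_, ihV1, ?_⟩
      · -- the equation for the next iterate
        intro p hp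
        rw [Function.iterate_succ', Function.comp]
        exact sheetOp_pdN_eq_zero hI hA hB hQd hμ hKj ihP p hp
      · -- the equation for the `j`-th iterate, read on the sheet, gives `Q · ∂_n^{j+2} = 0`
        intro s z hz
        set K := (pd eN)^[j] H with hK
        have hps : ((s, 0, z) : ℝ × ℝ × ℝ) ∈ slab I := sheet_mem_slab s hz
        have hPK := ihP (s, 0, z) hps
        have hS0 : eS.2.1 = 0 := rfl
        have hZ0 : eZ.2.1 = 0 := rfl
        -- smoothness
        have hKZ := contDiffOn_pd hI hKj eZ
        have hKS := contDiffOn_pd hI hKj eS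
        have hKN := contDiffOn_pd hI hKj eN
        -- `K` and `∂_nK` vanish on the sheet, hence so do their tangential derivatives
        have hK0 : ∀ s : ℝ, ∀ z ∈ I, K (s, 0, z) = 0 := ihV
        have hK1 : ∀ s : ℝ, ∀ z ∈ I, pd eN K (s, 0, z) = 0 := by
          intro s' z' hz'
          have := ihV1 s' z' hz'
          rwa [Function.iterate_succ', Function.comp] at this
        have hZ1 : ∀ s : ℝ, ∀ z ∈ I, pd eZ K (s, 0, z) = 0 := fun s' z' hz' =>
          pd_eq_zero_of_vanish_on_sheet hI hK0 hz' (differentiableAt_of_slab hI hKj (sheet_mem_slab s' hz')) hZ0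
        have hS1 : ∀ s : ℝ, ∀ z ∈ I, pd eS K (s, 0, z) = 0 := fun s' z' hz' =>
          pd_eq_zero_of_vanish_on_sheet hI hK0 hz' (differentiableAt_of_slab hI hKj (sheet_mem_slab s' hz')) hS0
        have tZZ : pd eZ (pd eZ K) (s, 0, z) = 0 :=
          pd_eq_zero_of_vanish_on_sheet hI hZ1 hz (differentiableAt_of_slab hI hKZ hps) hZ0
        have tSS : pd eS (pd eS K) (s, 0, z) = 0 :=
          pd_eq_zero_of_vanish_on_sheet hI hS1 hz (differentiableAt_of_slab hI hKS hps) hS0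
        have tZN : pd eZ (pd eN K) (s, 0, z) = 0 :=
          pd_eq_zero_of_vanish_on_sheet hI hK1 hz (differentiableAt_of_slab hI hKN hps) hZ0
        have tN : pd eN K (s, 0, z) = 0 := hK1 s z hz
        have hNN : Q z * pd eN (pd eN K) (s, 0, z) = 0 := by
          have h := hPK
          simp only [sheetOp, tZZ, tSS, tZN, tN, mul_zero, zero_add, add_zero] at h
          exact h
        have hres : pd eN (pd eN K) (s, 0, z) = 0 := by
          rcases mul_eq_zero.1 hNN with h | h
          · exact absurd h (hQ z hz)
          · exact h
        have e : (pd eN)^[j + 1 + 1] H = pd eN (pd eN K) := by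
          rw [hK, Function.iterate_succ', Function.iterate_succ']
          rfl
        rw [e]
        exact hres
  intro j s z hz
  exact (key j).2.1 s z hz

/-! ### The analytic conclusion -/

/-- The derivative of an `n`-line of `K` is the value of `∂_nK`. -/
theorem deriv_line_eq_pd {I : Set ℝ} (hI : IsOpen I) {K : ℝ × ℝ × ℝ → ℝ} (hK : ContDiffOn ℝ ∞ K (slab I))
    (s n : ℝ) {z : ℝ} (hz : z ∈ I) : deriv (fun m : ℝ => K (s, m, z)) n = pd eN K (s, n, z) := by
  have hp : ((s, n, z) : ℝ × ℝ × ℝ) ∈ slab I := hz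
  have hd : HasFDerivAt K (fderiv ℝ K (s, n, z)) ((fun m : ℝ => ((s, m, z) : ℝ × ℝ × ℝ)) n) :=
    (differentiableAt_of_slab hI hK hp).hasFDerivAt
  have hl : HasDerivAt (fun m : ℝ => ((s, m, z) : ℝ × ℝ × ℝ)) eN n := by
    have h1 : HasDerivAt (fun m : ℝ => m) 1 n := hasDerivAt_id n
    have h : HasDerivAt (fun m : ℝ => ((s, m, z) : ℝ × ℝ × ℝ)) ((0 : ℝ), (1 : ℝ), (0 : ℝ)) n :=
      (hasDerivAt_const n s).prodMk (h1.prodMk (hasDerivAt_const n z))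
    simpa [eN] using h
  have h : HasDerivAt (fun m : ℝ => K (s, m, z)) (fderiv ℝ K (s, n, z) eN) n := hd.comp_hasDerivAt n hl
  rw [h.deriv]
  rfl

/-- The iterated derivatives of an `n`-line are the values of the iterated normal derivatives. -/
theorem iteratedDeriv_line_eq {I : Set ℝ} (hI : IsOpen I) {H : ℝ × ℝ × ℝ → ℝ} (hH : ContDiffOn ℝ ∞ H (slab I))
    (s : ℝ) {z : ℝ} (hz : z ∈ I) :
    ∀ (j : ℕ) (n : ℝ), iteratedDeriv j (fun m : ℝ => H (s, m, z)) n = ((pd eN)^[j] H) (s, n, z) := by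
  intro j
  induction j with
  | zero => intro n; simp
  | succ j ih =>
    intro n
    rw [iteratedDeriv_succ, Function.iterate_succ', Function.comp]
    have e : iteratedDeriv j (fun m : ℝ => H (s, m, z)) = fun m => ((pd eN)^[j] H) (s, m, z) := funext ih
    rw [e]
    exact deriv_line_eq_pd hI (contDiffOn_iterate_pd hI hH eN j) s n hz

/-- **CAUCHY–KOVALEVSKAYA UNIQUENESS ACROSS A NON-CHARACTERISTIC SHEET.**  Let `H` be smooth on the open slab `{z ∈ I}`,
real-analytic along every `n`-line there, and solve `∂_z∂_zH + A∂_z∂_nH + B∂_nH + Q∂_n∂_nH + μ∂_s∂_sH = 0` on the slab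
with height-only differentiable coefficients and `Q ≠ 0` on `I`.  If `H` and `∂_nH` vanish on the sheet `{n = 0, z ∈ I}`,
then `H` vanishes on the whole slab. -/
theorem eq_zero_on_slab {I : Set ℝ} (hI : IsOpen I) {A B Q μ : ℝ → ℝ}
    (hA : ∀ z ∈ I, DifferentiableAt ℝ A z) (hB : ∀ z ∈ I, DifferentiableAt ℝ B z)
    (hQd : ∀ z ∈ I, DifferentiableAt ℝ Q z) (hμ : ∀ z ∈ I, DifferentiableAt ℝ μ z)
    (hQ : ∀ z ∈ I, Q z ≠ 0)
    {H : ℝ × ℝ × ℝ → ℝ} (hH : ContDiffOn ℝ ∞ H (slab I))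
    (han : ∀ s : ℝ, ∀ z ∈ I, AnalyticOnNhd ℝ (fun n : ℝ => H (s, n, z)) univ)
    (hpde : ∀ p ∈ slab I, sheetOp A B Q μ H p = 0)
    (h0 : ∀ s : ℝ, ∀ z ∈ I, H (s, 0, z) = 0) (h1 : ∀ s : ℝ, ∀ z ∈ I, pd eN H (s, 0, z) = 0) :
    ∀ (s n : ℝ), ∀ z ∈ I, H (s, n, z) = 0 := by
  intro s n z hz
  set φ : ℝ → ℝ := fun m => H (s, m, z) with hφ
  have hφan : AnalyticOnNhd ℝ φ univ := han s z hz
  have hφ0 : AnalyticAt ℝ φ 0 := hφan 0 (mem_univ _)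
  -- every Taylor coefficient at `n = 0` vanishes
  have hcoef : ∀ j : ℕ, iteratedDeriv j φ 0 = 0 := fun j => by
    rw [hφ, iteratedDeriv_line_eq hI hH s hz j 0]
    exact iterate_pdN_eq_zero_on_sheet hI hA hB hQd hμ hQ hH hpde h0 h1 j s z hz
  -- hence infinite analytic order: `φ` vanishes near `0`
  have htop : analyticOrderAt φ 0 = ⊤ := by
    rw [ENat.eq_top_iff_forall_ge]
    intro m
    rw [natCast_le_analyticOrderAt_iff_iteratedDeriv_eq_zero hφ0]
    exact fun i _ => hcoef i
  have hev : ∀ᶠ m in 𝓝 (0 : ℝ), φ m = 0 := analyticOrderAt_eq_top.1 htop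
  -- identity theorem along the whole line
  have hall := hφan.eqOn_zero_of_preconnected_of_eventuallyEq_zero isPreconnected_univ (mem_univ (0 : ℝ)) hev
  exact hall (mem_univ n)

end Summit.NavierStokesRegularity.NavierStokesRegularity.Theorems.PoloidalWindowDoorLrcModEntireSheetCauchyUniqueness
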